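import Summits.BirchSwinnertonDyer.BirchSwinnertonDyer.Theorems.AdditiveKolyvaginRoadLevelSystemsRigidityConnectedNonempty
import Summits.BirchSwinnertonDyer.BirchSwinnertonDyer.Theorems.AdditiveKolyvaginRoadLevelSystemsCoreConnected
import Summits.BirchSwinnertonDyer.BirchSwinnertonDyer.Theorems.AdditiveKolyvaginRoadKolyvaginPrimitiveAdditiveParityOfLevelInputs
import Summits.BirchSwinnertonDyer.BirchSwinnertonDyer.Theorems.AdditiveKolyvaginRoadEigen
import Summits.BirchSwinnertonDyer.BirchSwinnertonDyer.Theses.AdditiveKolyvaginRoad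
import HarnessLib

/-!
# Route `AdditiveKolyvaginRoad`, crux `LevelKolyvaginSystemsAdditive` (item stmt-BirchSwinnertonDyer-21396, KS′):
# KS′ BY NAME from a seed at a NON-EMPTY core level — the bottom-class binder `selmer_bottom` REMOVED
# (cell `pub/bsd-wall`, width seat `bsd-wall-akr-p2x-w2` g2; `--supports stmt-BirchSwinnertonDyer-21396`, helper; part 9b, after the
# abstract part 9a `…RigidityConnectedNonempty` and the appendix of part 1 `…RigidityCore`)

WHY. Parts 5–8 asked `selmer_bottom` («`κ₀(∅, ∅) = c(1)` is a signed Selmer class», Gross 1991 at conductor 1) only because the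
propagation wanted class membership at EVERY even level. Along Howard's paths between NON-EMPTY core levels the bottom `∅` is never
visited (part 9a), and at non-empty even levels membership is the carrier's own axioms (`sign` ∕ `selmer_inf` ∕ `selmer_off` ∕
`toric_on` at `m = ∅`). THIS FILE: `ne_zero_of_coreEdges_ne` (carrier propagation along the restricted relation),
`selQP_coreConnected_ne` (connectivity of the non-empty core levels at a ♯ frame, modulo (R′) + odd bottom rank), and
**`levelKolyvaginSystemsAdditive_of_seed_ne`**: the crux BY NAME ⟸ `PublishedInputsAdditiveKoly` ∧ `PublishedDualityInputsAdditiveKoly`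
∧ (R′) ∧ SEED-DATUM′, where SEED-DATUM′ = part 8's seed datum WITHOUT `selmer_bottom` and with the seed at a NON-EMPTY level of total
canonical rank `≤ 1` (an even `n₀ ≠ ∅` with `κ₀(∅, n₀) ≠ 0`, or an odd `n₀` — automatically non-empty — with `λ(∅, n₀)` a unit, e.g.
ONE anchor value at ONE one-prime level `{q}` with `Sel_{q}^± = 0`). The case `n₀ = ∅` (seed `c(1) ≢ 0`) stays with part 8.

HONEST FRAMING: theorems only; 0 definitions, 0 named facts, 0 `sorry`; CONDITIONAL on PUB ∕ DUAL, (R′) and the seed datum; closes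
nothing. BSD is not proved by any of this.

References: [cite: Howard2006Bipartite, Lemma 2.4.10, Prop. 2.4.11, Thm. 2.5.1] [cite: WZhang2014, §3, Thm. 4.3, (4.8), Lemma 5.3,
Prop. 5.4, Thm. 7.2, Lemma 7.3, Thm. 9.2, §9] [cite: BertoliniDarmon2005, Thm. 3.2, Thm. 4.1, Thm. 4.2] [cite: GrossLMS1991, §10].
-/

-- single-conjunct summit: `Summit.BirchSwinnertonDyer.BirchSwinnertonDyer.…` repeats the name by design
set_option linter.dupNamespace false

noncomputable section

open scoped Classical

namespace Summit.BirchSwinnertonDyer.BirchSwinnertonDyer.Theorems.AdditiveKoly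

open WeierstrassCurve NumberField IsDedekindDomain
  Literature.NumberTheory.EllipticCurves Literature.NumberTheory.EllipticCurves.ModularForms
  Literature.NumberTheory.EllipticCurves.Rank1Residual Literature.NumberTheory.GaloisRepresentations Module
  Summit.BirchSwinnertonDyer.Rank1Residual.X11b.Three.Koly
  Summit.BirchSwinnertonDyer.BirchSwinnertonDyer.Theses.AdditiveKolyvaginRoad

variable (W : WeierstrassCurve ℚ) (K : Type) [Field K] [NumberField K] (p : ℕ) [W.IsGloballyMinimal]
  (c : K ≃ₐ[ℚ] K) [Module (ZMod p) (Vp W K p)]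

/-! ## §1 Propagation along the restricted relation (carrier) -/

/-- **Propagation along Howard's core graph RESTRICTED TO NON-EMPTY LEVELS, for level-indexed classes and odd-level
values** (part 2's `ne_zero_of_coreEdges` with membership asked only at non-empty even levels). Original: Data: classes `κ n ∈ H¹(K, E[p])`
(even levels), value predicates `Λ n'` (odd levels, «`λ(n')` is a unit»), the TWO-SIDED laws (A) «`κ(n)` detected above a new
`q` ⟺ `Λ(n ∪ q)`» (`n` even) and (B) «`κ(n' ∪ q)` detected above the level prime `q` ⟺ `Λ(n')`» (`n'` odd) — Bertolini–Darmon
Thms 4.2 ∕ 4.1 as equalities up to units — and `κ(n) ∈ Sel_n^{some sign}` at even levels. THEN from ONE seed (a non-zero class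
at an even `n₀`, or a unit value at an odd `n₀`), `κ(n) ≠ 0` at every EVEN level `n` connected to `n₀` through core edges
(`Relation.EqvGen` of «`b = a ∪ {q}`, the odd end core», inline). [cite: Howard2006Bipartite, Cor. 2.3.5, Prop. 2.4.11,
Cor. 2.4.12, Thm. 2.5.1] [cite: BertoliniDarmon2005, Thm. 4.1, Thm. 4.2] [cite: WZhang2014, Thm. 7.2] -/
theorem ne_zero_of_coreEdges_ne (κ : Finset (AdmQ W K p) → Vp W K p) (Λ : Finset (AdmQ W K p) → Prop)
    (lawA : ∀ (n : Finset (AdmQ W K p)) (q : AdmQ W K p), Even n.card → q ∉ n →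
      ((∃ v : HeightOneSpectrum (𝓞 K), ((q : ℕ) : 𝓞 K) ∈ v.asIdeal ∧
        κ n ∉ (W.baseChange K).torsionLocalKer (v.adicCompletion K) ((p ^ 1 : ℕ) : ℤ)) ↔ Λ (insert q n)))
    (lawB : ∀ (n' : Finset (AdmQ W K p)) (q : AdmQ W K p), Odd n'.card → q ∉ n' →
      ((∃ v : HeightOneSpectrum (𝓞 K), ((q : ℕ) : 𝓞 K) ∈ v.asIdeal ∧
        κ (insert q n') ∉ (W.baseChange K).torsionLocalKer (v.adicCompletion K) ((p ^ 1 : ℕ) : ℤ)) ↔ Λ n'))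
    (hmem : ∀ n : Finset (AdmQ W K p), n.Nonempty → Even n.card → ∃ μ, κ n ∈ SelQP W K p c n μ)
    {n₀ n : Finset (AdmQ W K p)} (seed : (Even n₀.card ∧ κ n₀ ≠ 0) ∨ (Odd n₀.card ∧ Λ n₀)) (hn : Even n.card)
    (hpath : Relation.EqvGen (fun a b : Finset (AdmQ W K p) ↦ a.Nonempty ∧ ∃ q, q ∉ a ∧ b = insert q a ∧
        (Even a.card → SelQP W K p c (insert q a) true = ⊥ ∧ SelQP W K p c (insert q a) false = ⊥) ∧
        (Odd a.card → SelQP W K p c a true = ⊥ ∧ SelQP W K p c a false = ⊥)) n₀ n) :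
    κ n ≠ 0 := by
  have hIn : ∀ (n : Finset (AdmQ W K p)) (q : AdmQ W K p) (μ : Bool) (y : Vp W K p), q ∉ n → y ∈ SelQP W K p c n μ →
      (∀ v : HeightOneSpectrum (𝓞 K), ((q : ℕ) : 𝓞 K) ∈ v.asIdeal →
        y ∈ (W.baseChange K).torsionLocalKer (v.adicCompletion K) ((p ^ 1 : ℕ) : ℤ)) →
      y ∈ SelQP W K p c (insert q n) μ :=
    fun _ _ _ _ hqn hy hT ↦ mem_selQP_insert_of_forall_mem_torsionLocalKer W K p c hqn hy hT
  have hOut : ∀ (n : Finset (AdmQ W K p)) (q : AdmQ W K p) (μ : Bool) (z : Vp W K p), q ∉ n →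
      z ∈ SelQP W K p c (insert q n) μ →
      (∀ v : HeightOneSpectrum (𝓞 K), ((q : ℕ) : 𝓞 K) ∈ v.asIdeal →
        z ∈ (W.baseChange K).torsionLocalKer (v.adicCompletion K) ((p ^ 1 : ℕ) : ℤ)) →
      z ∈ SelQP W K p c n μ :=
    fun _ _ _ _ _ hz hT ↦ mem_selQP_of_mem_selQP_insert_of_forall_mem_torsionLocalKer W K p c hz hT
  have lawA' : ∀ (n : Finset (AdmQ W K p)) (q : AdmQ W K p), Even n.card → q ∉ n →
      ((¬ ∀ v : HeightOneSpectrum (𝓞 K), ((q : ℕ) : 𝓞 K) ∈ v.asIdeal →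
        κ n ∈ (W.baseChange K).torsionLocalKer (v.adicCompletion K) ((p ^ 1 : ℕ) : ℤ)) ↔ Λ (insert q n)) :=
    fun n q hn hqn ↦ (not_forall_mem_torsionLocalKer_iff W K p).trans (lawA n q hn hqn)
  have lawB' : ∀ (n' : Finset (AdmQ W K p)) (q : AdmQ W K p), Odd n'.card → q ∉ n' →
      ((¬ ∀ v : HeightOneSpectrum (𝓞 K), ((q : ℕ) : 𝓞 K) ∈ v.asIdeal →
        κ (insert q n') ∈ (W.baseChange K).torsionLocalKer (v.adicCompletion K) ((p ^ 1 : ℕ) : ℤ)) ↔ Λ n') :=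
    fun n' q hn' hqn' ↦ (not_forall_mem_torsionLocalKer_iff W K p).trans (lawB n' q hn' hqn')
  rcases seed with ⟨hn₀, h0⟩ | ⟨hn₀, h0⟩
  · exact CoreGraph.ne_zero_of_eqvGen_ne (SelQP W K p c)
      (fun (q : AdmQ W K p) (y : Vp W K p) ↦ ∀ v : HeightOneSpectrum (𝓞 K), ((q : ℕ) : 𝓞 K) ∈ v.asIdeal →
        y ∈ (W.baseChange K).torsionLocalKer (v.adicCompletion K) ((p ^ 1 : ℕ) : ℤ))
      κ Λ hIn hOut (fun _ _ _ ↦ zero_mem _) lawA' lawB' hmem hn₀ h0 hn hpath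
  · exact CoreGraph.ne_zero_of_eqvGen_of_value_ne (SelQP W K p c)
      (fun (q : AdmQ W K p) (y : Vp W K p) ↦ ∀ v : HeightOneSpectrum (𝓞 K), ((q : ℕ) : 𝓞 K) ∈ v.asIdeal →
        y ∈ (W.baseChange K).torsionLocalKer (v.adicCompletion K) ((p ^ 1 : ℕ) : ℤ))
      κ Λ hIn hOut (fun _ _ _ ↦ zero_mem _) lawA' lawB' hmem hn₀ h0 hn hpath


/-! ## §2 Connectivity of the non-empty core levels at a ♯ frame -/

section Frame

variable [W.IsElliptic] [Fact p.Prime]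

/-- **THE CARRIER'S CORE GRAPH ON NON-EMPTY LEVELS IS CONNECTED at a ♯ additive frame, modulo (R′) and odd bottom rank**
(part 5's `selQP_coreConnected` along the relation restricted to non-empty lower ends, for a NON-EMPTY `n₀`). Original: At `p ≥ 5` additive with `ρ̄_{E,p}` onto, `K` imaginary quadratic with the Heegner hypothesis for `N_E`, `c ≠ 1`:
GIVEN (R′) — for `q ∉ m` admissible of sign `μ` (complex conjugation acts on `H¹(K_v, E[p])` by `sgnP μ`, `v ∣ q`), if every
class of `Sel_m^μ` is locally trivial above `q` then `Sel_m^μ ≤ Sel_{m∪q}^μ` with `dim Sel_{m∪q}^μ = dim Sel_m^μ + 1` (W. Zhang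
Lemma 5.3, raising half; Poitou–Tate) — and `dim Sel_∅⁺ + dim Sel_∅⁻` ODD: every non-empty even level of canonical rank one is
joined to any level `n₀` of total rank `≤ 1` through core edges (`b = a ∪ {q}`, the odd end having `Sel^± = 0`). The other
inputs of Howard's Prop. 2.4.11 are DISCHARGED here: the sign `ε_q` by (Equiv) `localEquiv_of_admQ`, (Inert) by (9.2)
(`mem_torsionLocalKer_of_localSign_ne` + `selQP_insert_eq_of_forall_mem_torsionLocalKer`), (Lower) at a given prime by
`selQP_lower_of_detected`, signed (Cheb) by `exists_admQ_notMem_torsionLocalKer`, bookkeeping and finiteness by parts 1–2 and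
`finiteDimensional_selQP`. [cite: Howard2006Bipartite, Prop. 2.4.11] [cite: WZhang2014, Lemma 5.3, Prop. 5.4, Lemma 7.3, §9] -/
theorem selQP_coreConnected_ne (h5 : 5 ≤ p) (hadd : Addv W p) (hsurj : W.HasSurjectiveModNGaloisRep p)
    (hK : IsImaginaryQuadratic K) (hH : SatisfiesHeegnerHypothesis (W.conductorNorm ℤ) K) (hc1 : c ≠ 1)
    (hraise : ∀ (m : Finset (AdmQ W K p)) (q : AdmQ W K p) (μ : Bool), q ∉ m →
      (∀ v : HeightOneSpectrum (𝓞 K), ((q : ℕ) : 𝓞 K) ∈ v.asIdeal → ∀ z : Vp W K p,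
        (W.baseChange K).torsionLocMap (v.adicCompletion K) ((p ^ 1 : ℕ) : ℤ) (conjAct W c ((p ^ 1 : ℕ) : ℤ) z) =
          sgnP μ • (W.baseChange K).torsionLocMap (v.adicCompletion K) ((p ^ 1 : ℕ) : ℤ) z) →
      (∀ x ∈ SelQP W K p c m μ, ∀ v : HeightOneSpectrum (𝓞 K), ((q : ℕ) : 𝓞 K) ∈ v.asIdeal →
        x ∈ (W.baseChange K).torsionLocalKer (v.adicCompletion K) ((p ^ 1 : ℕ) : ℤ)) →
      SelQP W K p c m μ ≤ SelQP W K p c (insert q m) μ ∧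
        finrank (ZMod p) (SelQP W K p c (insert q m) μ) = finrank (ZMod p) (SelQP W K p c m μ) + 1)
    (hodd : Odd (finrank (ZMod p) (SelQP W K p c ∅ true) + finrank (ZMod p) (SelQP W K p c ∅ false)))
    {n₀ : Finset (AdmQ W K p)}
    (hn₀ : finrank (ZMod p) (SelQP W K p c n₀ true) + finrank (ZMod p) (SelQP W K p c n₀ false) ≤ 1)
    (hn₀ne : n₀.Nonempty) :
    ∀ n : Finset (AdmQ W K p), n.Nonempty → Even n.card →
      finrank (ZMod p) (SelQP W K p c n true) + finrank (ZMod p) (SelQP W K p c n false) = 1 →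
      Relation.EqvGen (fun a b : Finset (AdmQ W K p) ↦ a.Nonempty ∧ ∃ q, q ∉ a ∧ b = insert q a ∧
        (Even a.card → SelQP W K p c (insert q a) true = ⊥ ∧ SelQP W K p c (insert q a) false = ⊥) ∧
        (Odd a.card → SelQP W K p c a true = ⊥ ∧ SelQP W K p c a false = ⊥)) n₀ n := by
  have hp : Odd p := (Fact.out : p.Prime).odd_of_ne_two (by omega)
  -- the sign of each admissible prime, by (Equiv)
  choose ε hε using localEquiv_of_admQ W K p hK.1 hc1
  -- (9.2): a `(¬ε q)`-eigenclass is locally trivial above `q`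
  have hInertT : ∀ (q : AdmQ W K p) (y : Vp W K p), conjAct W c ((p ^ 1 : ℕ) : ℤ) y = sgnP (!ε q) • y →
      ∀ v : HeightOneSpectrum (𝓞 K), ((q : ℕ) : 𝓞 K) ∈ v.asIdeal →
        y ∈ (W.baseChange K).torsionLocalKer (v.adicCompletion K) ((p ^ 1 : ℕ) : ℤ) :=
    fun q y hy v hv ↦ mem_torsionLocalKer_of_localSign_ne W K p c hp (hε q v hv) hy
  refine CoreGraph.connected_of_dichotomy_ne (SelQP W K p c)
    (fun (q : AdmQ W K p) (y : Vp W K p) ↦ ∀ v : HeightOneSpectrum (𝓞 K), ((q : ℕ) : 𝓞 K) ∈ v.asIdeal →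
      y ∈ (W.baseChange K).torsionLocalKer (v.adicCompletion K) ((p ^ 1 : ℕ) : ℤ)) ε
    (fun m μ ↦ finiteDimensional_selQP W K p c m μ)
    (fun _ _ _ _ hqn hy hT ↦ mem_selQP_insert_of_forall_mem_torsionLocalKer W K p c hqn hy hT)
    (fun _ _ _ _ _ hz hT ↦ mem_selQP_of_mem_selQP_insert_of_forall_mem_torsionLocalKer W K p c hz hT)
    (fun m q hqm ↦ selQP_insert_eq_of_forall_mem_torsionLocalKer W K p c m q hqm (!ε q) (hInertT q))
    (fun m q y hy ↦ hInertT q y (conjAct_eq_of_mem_selQP W K p c m (!ε q) hy))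
    (fun m q hqm hx ↦ ?_) (fun m q hqm hx ↦ hraise m q (ε q) hqm (hε q) hx) (fun B m μ x hx hx0 ↦ ?_) hodd hn₀ hn₀ne
  · -- (Lower) at the given detected prime, Poitou–Tate-free (§1)
    obtain ⟨x, hx, hTx⟩ := hx
    obtain ⟨v, hv, hxv⟩ := (not_forall_mem_torsionLocalKer_iff W K p).mp hTx
    have hvx : (W.baseChange K).torsionLocMap (v.adicCompletion K) ((p ^ 1 : ℕ) : ℤ) x ≠ 0 :=
      fun h ↦ hxv (AddMonoidHom.mem_ker.mpr h)
    obtain ⟨hle, hrank, htriv, -⟩ := selQP_lower_of_detected W K p c hK hp hc1 hqm hx hv hvx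
    exact ⟨hle, hrank, htriv⟩
  · -- signed Čebotarev: a detecting prime outside `B`; its sign is that of the detected class
    obtain ⟨q, hqB, v, hv, hxv⟩ := exists_admQ_notMem_torsionLocalKer W K p c h5 hadd hsurj hK hH hc1 hx hx0 B
    refine ⟨q, hqB, ?_, fun hall ↦ hxv (hall v hv)⟩
    by_contra hne
    have hμ : μ = !ε q := by
      revert hne
      cases μ <;> cases ε q <;> decide
    exact hxv (hInertT q x (hμ ▸ conjAct_eq_of_mem_selQP W K p c m μ hx) v hv)

end Frame

/-! ## §3 KS′ by name from a seed at a non-empty core level, without `selmer_bottom` -/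

/-- **KS′ BY NAME FROM A SEED DATUM AT A NON-EMPTY LEVEL, granted PUB ∕ DUAL and (R′) — NO hypothesis on the bottom class
`c(1)`** (part 8's `levelKolyvaginSystemsAdditive_of_seed` with `selmer_bottom` REMOVED and the seed level asked non-empty:
Howard's paths between non-empty core levels never visit `∅`). Original: If (R′) witness-free one-prime raising holds for the
canonical spaces of every `(E, K, p, c)` with `K` imaginary quadratic and `c ≠ 1`, and at every ♯ additive frame of the route
and every complex conjugation `c ≠ 1` there is a SEED DATUM — signs, even-level classes with the realisation identity and the
local Kolyvagin-system axioms at even non-empty levels, odd-level values, the laws (A), (B) two-sided, the bottom class a signed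
Selmer class, and ONE seed at a level of total canonical rank `≤ 1` — then, granted `PublishedInputsAdditiveKoly` and
`PublishedDualityInputsAdditiveKoly`, the crux `LevelKolyvaginSystemsAdditive` holds. [cite: WZhang2014, §3, Thm. 4.3, Thm. 7.2,
Thm. 9.2, §9] [cite: Howard2006Bipartite, Thm. 2.5.1] [cite: BertoliniDarmon2005, Thm. 4.1, Thm. 4.2] -/
theorem levelKolyvaginSystemsAdditive_of_seed_ne (hPUB : PublishedInputsAdditiveKoly)
    (hDual : PublishedDualityInputsAdditiveKoly)
    (hR : ∀ (W : WeierstrassCurve ℚ) [W.IsElliptic] [W.IsGloballyMinimal] (p : ℕ) [Fact p.Prime]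
      (K : Type) [Field K] [NumberField K] (c : K ≃ₐ[ℚ] K) [Module (ZMod p) (Vp W K p)],
      5 ≤ p → IsImaginaryQuadratic K → c ≠ 1 →
      ∀ (m : Finset (AdmQ W K p)) (q : AdmQ W K p) (μ : Bool), q ∉ m →
      (∀ v : HeightOneSpectrum (𝓞 K), ((q : ℕ) : 𝓞 K) ∈ v.asIdeal → ∀ z : Vp W K p,
        (W.baseChange K).torsionLocMap (v.adicCompletion K) ((p ^ 1 : ℕ) : ℤ) (conjAct W c ((p ^ 1 : ℕ) : ℤ) z) =
          sgnP μ • (W.baseChange K).torsionLocMap (v.adicCompletion K) ((p ^ 1 : ℕ) : ℤ) z) →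
      (∀ x ∈ SelQP W K p c m μ, ∀ v : HeightOneSpectrum (𝓞 K), ((q : ℕ) : 𝓞 K) ∈ v.asIdeal →
        x ∈ (W.baseChange K).torsionLocalKer (v.adicCompletion K) ((p ^ 1 : ℕ) : ℤ)) →
      SelQP W K p c m μ ≤ SelQP W K p c (insert q m) μ ∧
        finrank (ZMod p) (SelQP W K p c (insert q m) μ) = finrank (ZMod p) (SelQP W K p c m μ) + 1)
    (H : ∀ (W : WeierstrassCurve ℚ) [W.IsElliptic] [W.IsGloballyMinimal] [NeZero (W.conductorNorm ℤ)]
      (p : ℕ) [Fact p.Prime] (K : Type) [Field K] [NumberField K]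
      (Dt : ModularParametrizationData W (W.conductorNorm ℤ)) (β : ℤ) (ι : K →+* ℂ),
      5 ≤ p → Addv W p → W.HasSurjectiveModNGaloisRep p →
      (∀ (ℓ : ℕ) [Fact ℓ.Prime], W.HasMultiplicativeReductionAtPrime ℓ →
        ¬ p ∣ padicValInt ℓ W.minimalDiscriminantInt) →
      (∃ (ℓ₁ ℓ₂ : ℕ) (_ : Fact ℓ₁.Prime) (_ : Fact ℓ₂.Prime), ℓ₁ ≠ ℓ₂ ∧
        W.HasMultiplicativeReductionAtPrime ℓ₁ ∧ W.HasMultiplicativeReductionAtPrime ℓ₂) →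
      ¬ p ∣ W.tamagawaProduct → W.analyticRank = 1 →
      IsImaginaryQuadratic K → Odd (NumberField.discr K) → NumberField.discr K < -4 →
      SatisfiesHeegnerHypothesis (W.conductorNorm ℤ) K →
      (W.quadraticTwist (NumberField.discr K : ℚ)).entireLFunction 1 ≠ 0 →
      (4 * (W.conductorNorm ℤ : ℤ)) ∣ β ^ 2 - NumberField.discr K → ¬ (p : ℤ) ∣ Dt.c →
      ∀ (c : K ≃ₐ[ℚ] K), c ≠ 1 → ∀ [Module (ZMod p) (Vp W K p)],
      ∃ (ε₀ : Finset (AdmQ W K p) → Bool)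
        (κ₀ : Finset {ℓ // Zhang2014.IsKolyvaginPrime (W.conductorNorm ℤ) W K p ℓ} → Finset (AdmQ W K p) → Vp W K p)
        (lam : Finset {ℓ // Zhang2014.IsKolyvaginPrime (W.conductorNorm ℤ) W K p ℓ} → Finset (AdmQ W K p) → ZMod p)
        (n₀ : Finset (AdmQ W K p)),
        -- realisation at level `∅`
        (∀ m : Finset {ℓ // Zhang2014.IsKolyvaginPrime (W.conductorNorm ℤ) W K p ℓ},
          ∃ d : KolyvaginHeegnerData Dt β ι (∏ ℓ ∈ m, (ℓ : ℕ)), κ₀ m ∅ = d.kolyvaginClass (Fact.out : p.Prime) 1) ∧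
        -- sign
        (∀ n : Finset (AdmQ W K p), n.Nonempty → Even n.card →
          ∀ m : Finset {ℓ // Zhang2014.IsKolyvaginPrime (W.conductorNorm ℤ) W K p ℓ},
          conjAct W c ((p ^ 1 : ℕ) : ℤ) (κ₀ m n) = sgnP (ε₀ n ^^ Nat.bodd m.card) • κ₀ m n) ∧
        -- selmer_off
        (∀ n : Finset (AdmQ W K p), n.Nonempty → Even n.card →
          ∀ (m : Finset {ℓ // Zhang2014.IsKolyvaginPrime (W.conductorNorm ℤ) W K p ℓ}) (v : HeightOneSpectrum (𝓞 K)),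
          (∀ ℓ ∈ m, ((ℓ : ℕ) : 𝓞 K) ∉ v.asIdeal) → (∀ q ∈ n, ((q : ℕ) : 𝓞 K) ∉ v.asIdeal) →
          κ₀ m n ∈ selmerLocalKer (W.baseChange K) (v.adicCompletion K) ((p ^ 1 : ℕ) : ℤ)) ∧
        -- selmer_inf
        (∀ n : Finset (AdmQ W K p), n.Nonempty → Even n.card →
          ∀ (m : Finset {ℓ // Zhang2014.IsKolyvaginPrime (W.conductorNorm ℤ) W K p ℓ}) (w : InfinitePlace K),
          κ₀ m n ∈ selmerLocalKer (W.baseChange K) w.Completion ((p ^ 1 : ℕ) : ℤ)) ∧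
        -- toric_on
        (∀ n : Finset (AdmQ W K p), n.Nonempty → Even n.card →
          ∀ m : Finset {ℓ // Zhang2014.IsKolyvaginPrime (W.conductorNorm ℤ) W K p ℓ}, ∀ q ∈ n,
          ∀ v : HeightOneSpectrum (𝓞 K), ((q : ℕ) : 𝓞 K) ∈ v.asIdeal →
          κ₀ m n ∈ toricLocalKer (W.baseChange K) (v.adicCompletion K) ((p ^ 1 : ℕ) : ℤ)) ∧
        -- transverse_on
        (∀ n : Finset (AdmQ W K p), n.Nonempty → Even n.card →
          ∀ m : Finset {ℓ // Zhang2014.IsKolyvaginPrime (W.conductorNorm ℤ) W K p ℓ}, ∀ ℓ ∈ m,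
          ∀ v : HeightOneSpectrum (𝓞 K), ((ℓ : ℕ) : 𝓞 K) ∈ v.asIdeal → κ₀ m n ∈ transverseLocalKerP W K p ι ℓ v) ∧
        -- relation (8.1)
        (∀ n : Finset (AdmQ W K p), n.Nonempty → Even n.card →
          ∀ (m : Finset {ℓ // Zhang2014.IsKolyvaginPrime (W.conductorNorm ℤ) W K p ℓ})
            (ℓ : {ℓ // Zhang2014.IsKolyvaginPrime (W.conductorNorm ℤ) W K p ℓ}), ℓ ∉ m →
          ∀ v : HeightOneSpectrum (𝓞 K), ((ℓ : ℕ) : 𝓞 K) ∈ v.asIdeal →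
          (κ₀ (insert ℓ m) n ∈ (W.baseChange K).torsionLocalKer (v.adicCompletion K) ((p ^ 1 : ℕ) : ℤ) ↔
            κ₀ m n ∈ (W.baseChange K).torsionLocalKer (v.adicCompletion K) ((p ^ 1 : ℕ) : ℤ))) ∧
        -- law (A), TWO-SIDED: the value one level up is a unit iff the class is detected at the NEW prime
        (∀ (n : Finset (AdmQ W K p)) (q : AdmQ W K p), Even n.card → q ∉ n →
          ∀ m : Finset {ℓ // Zhang2014.IsKolyvaginPrime (W.conductorNorm ℤ) W K p ℓ},
          lam m (insert q n) ≠ 0 ↔ ∃ v : HeightOneSpectrum (𝓞 K), ((q : ℕ) : 𝓞 K) ∈ v.asIdeal ∧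
            κ₀ m n ∉ (W.baseChange K).torsionLocalKer (v.adicCompletion K) ((p ^ 1 : ℕ) : ℤ)) ∧
        -- law (B), TWO-SIDED: the class is detected at a LEVEL prime iff the value one level down is a unit
        (∀ (n : Finset (AdmQ W K p)) (q : AdmQ W K p), Odd n.card → q ∉ n →
          ∀ m : Finset {ℓ // Zhang2014.IsKolyvaginPrime (W.conductorNorm ℤ) W K p ℓ},
          (∃ v : HeightOneSpectrum (𝓞 K), ((q : ℕ) : 𝓞 K) ∈ v.asIdeal ∧
            κ₀ m (insert q n) ∉ (W.baseChange K).torsionLocalKer (v.adicCompletion K) ((p ^ 1 : ℕ) : ℤ)) ↔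
            lam m n ≠ 0) ∧
        -- ONE seed at a NON-EMPTY level of total canonical rank ≤ 1
        n₀.Nonempty ∧ finrank (ZMod p) (SelQP W K p c n₀ true) + finrank (ZMod p) (SelQP W K p c n₀ false) ≤ 1 ∧
        ((Even n₀.card ∧ κ₀ ∅ n₀ ≠ 0) ∨ (Odd n₀.card ∧ lam ∅ n₀ ≠ 0))) :
    LevelKolyvaginSystemsAdditive := by
  intro W _ _ _ p _ K _ _ Dt β ι h5 hadd hsurj hsp htwo htam hr hK hodd hlt hH hL hβ hcM c hc1 _
  obtain ⟨ε₀, κ₀, lam, n₀, hreal, hsign, hoff, hinf, htor, htr, hrel, hA, hB, hn₀ne, hcore₀, hseed⟩ :=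
    H W p K Dt β ι h5 hadd hsurj hsp htwo htam hr hK hodd hlt hH hL hβ hcM c hc1
  -- parity of `dim Sel_p(E/K)` from the published inputs, in the `SelQP ∅` currency
  have hp : p.Prime := Fact.out
  have hp2 : p ≠ 2 := by omega
  have hpar : Odd (finrank (ZMod p) (SelQP W K p c ∅ true) + finrank (ZMod p) (SelQP W K p c ∅ false)) := by
    obtain ⟨s, hsodd, hs⟩ := oddSelmerRankAdditive_of_levelInputs hPUB.1 hPUB.2.1 hPUB.2.2.2.2.1 hDual.1 W p K Dt β ι
      h5 hadd hsurj hsp htwo htam hr hK hodd hH hL hβ hcM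
    have e1 : ((p ^ 1 : ℕ) : ℤ) = (p : ℤ) := by simp
    have hs' : Nat.card (selmerGroup (W.baseChange K) ((p ^ 1 : ℕ) : ℤ)) = p ^ s := by rw [e1]; exact hs
    have hcard := natCard_selmer_eq_pow_finrank_selQP_add W K p hp2 hK c (Method2.algEquiv_mul_self_eq_one K hK c)
    rw [hs'] at hcard
    rwa [← Nat.pow_right_injective hp.two_le hcard]
  -- membership of the conductor-one classes at NON-EMPTY even levels (the carrier's own axioms; nothing at `∅`)
  have hmem : ∀ n : Finset (AdmQ W K p), n.Nonempty → Even n.card → ∃ μ, κ₀ ∅ n ∈ SelQP W K p c n μ := by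
    intro n hne hn
    refine ⟨ε₀ n, (mem_selQP_iff W K p c n (ε₀ n) _).mpr ⟨?_, hinf n hne hn ∅, fun v hv ↦ ?_,
      fun q hq v hqv ↦ htor n hne hn ∅ q hq v hqv⟩⟩
    · simpa only [Finset.card_empty, Nat.bodd_zero, Bool.xor_false] using hsign n hne hn ∅
    · exact hoff n hne hn ∅ v (fun ℓ hℓ ↦ absurd hℓ (Finset.notMem_empty ℓ)) hv
  have hconn := selQP_coreConnected_ne W K p c h5 hadd hsurj hK hH hc1 (hR W p K c h5 hK hc1) hpar hcore₀ hn₀ne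
  refine nonempty_levelKolyvaginSystemP_of_evenLevels W K p c Dt β ι ε₀ κ₀ hreal hsign hoff hinf htor htr hrel
    (transport_of_reciprocityLaws W K p (fun n q hn hq m h ↦ (hA n q hn hq m).mp h)
      (fun n q hn hq m v hv h ↦ (hB n q hn hq m).mp ⟨v, hv, h⟩)) ?_
  intro n hne he h1
  exact ne_zero_of_coreEdges_ne W K p c (κ₀ ∅) (fun n' ↦ lam ∅ n' ≠ 0)
    (fun n q hn hq ↦ (hA n q hn hq ∅).symm) (fun n' q hn' hq ↦ hB n' q hn' hq ∅) hmem hseed he (hconn n hne he h1)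

end Summit.BirchSwinnertonDyer.BirchSwinnertonDyer.Theorems.AdditiveKoly

end
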